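/-
Copyright (c) 2026 the pub-hodgecm-mathlib formalisation cell (harness21).  Prover seat hodgecm-mathlib-K2Liu-p14 (g0): Track B «K2-LIT»,
hLiu418 = stmt-HodgeConjecture-24832; LEAD F0P6-plan (g12) RULING M-156m 2026-09-04T07:51:54Z «A7 = GK COCYCLE ROAD», file B6.
-/
import Summits.HodgeConjecture.HodgeConjecture.Theorems.K2LiuQRationalLFactor     -- ★ (a) `comp_affine`, `one_sub_mul_qVar_ne_zero`; brings ★ F1 `K2LiuQRationalDefs` + ★ T1 `K2LiuLocalLFactorDefs`
import HarnessLib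

/-!
# Crux `HLiu418`, road `K2_Liu`, organ A7-reg (RULING M-156m, GK cocycle road), file B6:
# RANK-ONE FAMILIES — «head + `L`-factor × tail» IS «`L`-factor × (regular at `s₀`)», and linearity over a finite expansion

Cell `hodgecm-mathlib`, crux item hLiu418 = `stmt-HodgeConjecture-24832`; squad K2 ∕ K2Liu; prover K2Liu-p14 (g0).
THEOREMS ONLY (no `def`, no instance, no notation, no named-fact hypothesis, no `sorry`); lane `--supports stmt-HodgeConjecture-24832`
(count-neutral helper).

THE ROLE OF THIS FILE.  In the Gindikin–Karpelevich cocycle `M_w(s) = A₂ ∘ A₁ ∘ A₂` for the local Siegel intertwining operator of the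
doubled `U(2,2)` (A7 census `K2/K2Liu-p09/g5/REPORT-FIRST-A7-BadPlaceRegularity.K2Liu-p09-g5.md` §3, files B1–B8), each rank-one factor
`A_α` applied to a level-`K′` section is a rank-one integral over the root line `K_w`, which file B5 (`K2LiuRankOneLevelHolomorphy.
integrable_and_integral_eq`, K2Liu-p09 (g5)) evaluates in closed form as
  `∫ g = HEAD + T · ((unramValue ν · q_w^{1−e})^{m+1} · L(e − 1, ν))`,   `HEAD = Σ_{y∈R} μ(𝔭^r) g(y)`,  `T = C (1 − q_w⁻¹) μ(𝒪_w)`.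
Along a FAMILY `s ↦ g_s` (sections `f_s ∈ I_w(s, χ)`, fixed level) the data `m, r, R, ν` do not move, the head values `g_s(y)` and the
tail constant `C(s) = c · f_s(h)` are rational functions of `q_w^{-s}` regular at `s₀` (`= ½` at use), and `e(s) = ⟨λ_s, α^∨⟩ + 1` is
affine in `s`.  This file is the `s`-BOOKKEEPING of that situation and is GROUP-FREE (it never names `H_v`; the group glue — that the
integrand `x ↦ f_s(w_α u_α(x) h)` has B5's head∕tail shape uniformly in `s` — is file B3's letter):
* §1 (base `q`, point `s₀`): powers of regular functions; `q^{1 − (a s + c₀)} = q^{1−c₀} (q^{-s})^a` is a monomial, hence regular; the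
  normalised-tail identity `P + T · (t^{m+1} (1 − t)⁻¹) = (1 − t)⁻¹ · ((1 − t) P + T t^{m+1})`; regularity of that bracket.
* §2 (a completion `K_w`, ★ T1 currency `unramValue`, `lFactor`, B5's output shape carried BY VALUE; RULING M-156o (b) «ONE BOOKKEEPER,
  never divide by `L`»): the NORMAL FORM of the rank-one operator along the family is the EXPLICIT bracket
    **`N_α f_s := (1 − unramValue ν · q_w^{1−e(s)}) · HEAD(s) + T(s) · (unramValue ν · q_w^{1−e(s)})^{m+1}`**   (head + tail coefficient),
  and on a set `S` of parameters with `1 < re e(s)` (absolute convergence), for `‖unramValue ν‖ ≤ 1` (unitary `ν`, ★ (a) `norm_unramValue_le_one`),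
    **`A_α f_s = I(s) = L(e(s) − 1, ν) · N_α f_s`**   (`eq_lFactor_mul_of_head_tail`);
  **`N_α f_s` is `q_w^{-s}`-rational and regular at `s₀`** as soon as `HEAD`, `T` and `s ↦ q_w^{1−e(s)}` are (`isQRationalRegularAt_normalForm`)
  — so the normalised rank-one operator preserves regularity at `s₀`, at EVERY finite place, for EVERY unitary `ν` (ramified `ν`: dead factor,
  `unramValue ν = 0`, `N_α f_s = HEAD(s)`), and the third cocycle factor's pole (`L_F(2s−1, χ_F)` at `½`) never enters a denominator.  Packaged as
  `∃ Fn, IsQRationalRegularAt q_w s₀ Fn ∧ ∀ s ∈ S, I s = L(e s − 1, ν) · Fn s` (`exists_regular_factorisation`) — the sentence shape of the repaired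
  face (A4′-R) per rank-one factor; `s₀` is arbitrary, so «regular at every `s₀`» data give an «entire» `N_α f_s` (`exists_entire_factorisation`).
  Where the `L`-factor itself is alive-regular (`1 < re e(s₀)`: the first two cocycle factors at `s₀ = ½`) the continuation `L · N_α f_s` of
  `A_α f_s` is regular at `s₀` too.  Consumers (B3 `K2LiuRankOneOperators`' family junction, B7 `K2LiuA7NormalisedRegularity`) SEE the explicit
  bracket — three of them are multiplied across the cocycle — and use the `∃`-package only at the very end.
* §3 LINEARITY over a finite expansion (file B2's values on representatives of `B \ H_w / K′`): finite sums `Σ_i c_i(s) I_i(s)` of such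
  factorisations with regular coefficients are again `L(e(s) − 1, ν) ×` (regular at `s₀`).
The level-`K′` family theorem that consumes B5 BY NAME (B5's binders per `s ∈ S` with `(m, r, R, ν)` fixed) is appended as §4 once B5 is ★.
HONEST LABEL.  `HC_CM` is proved only modulo the 7 printed citations (2 remaining named inputs: hLiu418 = `stmt-HodgeConjecture-24832`,
h413 = `stmt-HodgeConjecture-24833`) until rung 0 closes.

## References
* [Casselman1980] W. Casselman, *The unramified principal series of p-adic groups I*, Compositio Math. 40 (1980), §3 Thm. 3.1 (rank-one `c_α(λ)`,
  rationality in `q^{-s}` of `T_w` on `K′`-fixed vectors, cocycle `T_w = Π T_α`).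
* [KudlaSweet1997] S. Kudla, W. J. Sweet, Israel J. Math. 98 (1997), §1 (the normalised operator is entire; poles of `a_n`, `b_n`).
* [Tate1950] J. Tate, *Fourier analysis in number fields and Hecke's zeta-functions* (1950), §2.4–2.5 (shell sums, `(1 − μ(ϖ)q^{-s})⁻¹`).
* [HarrisKudlaSweet1996] M. Harris, S. Kudla, W. J. Sweet, J. Amer. Math. Soc. 9 (1996), §6 (6.14)–(6.16) (`a_n`, `b_n`).
-/

set_option autoImplicit false
set_option linter.dupNamespace false -- the mandated namespace repeats `HodgeConjecture.HodgeConjecture`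

noncomputable section

open Polynomial NumberField IsDedekindDomain
open Literature.NumberTheory.GaloisRepresentations Literature.NumberTheory.GaloisRepresentations.IsNonarchimedeanLocalField
open Summit.HodgeConjecture.HodgeConjecture.Cruxes.HLiu418.K2LiuQRationalDefs
open Summit.HodgeConjecture.HodgeConjecture.Cruxes.HLiu418.K2LiuLocalLFactorDefs
open Summit.HodgeConjecture.HodgeConjecture.Cruxes.HLiu418.K2LiuQRationalLFactor

namespace Summit.HodgeConjecture.HodgeConjecture.Cruxes.HLiu418.K2LiuRankOneFamilies

/-! ## §1 Base `q`, point `s₀`: powers, the monomial `q^{1 − (a s + c₀)}`, the normalised-tail identity and its bracket -/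

section Generic

variable {q : ℕ} {s₀ : ℂ} {φ : ℂ → ℂ}

/-- natural powers of a function regular at `s₀` are regular at `s₀`. [cite: Casselman1980, §3] -/
theorem _root_.Summit.HodgeConjecture.HodgeConjecture.Cruxes.HLiu418.K2LiuQRationalDefs.IsQRationalRegularAt.pow
    (hφ : IsQRationalRegularAt q s₀ φ) (k : ℕ) : IsQRationalRegularAt q s₀ fun s => φ s ^ k := by
  induction k with
  | zero => simpa using isQRationalRegularAt_const q s₀ 1
  | succ k ih => simpa [pow_succ] using ih.mul hφ

/-- natural powers of a rational function of `q^{-s}` are rational. [cite: Casselman1980, §3] -/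
theorem _root_.Summit.HodgeConjecture.HodgeConjecture.Cruxes.HLiu418.K2LiuQRationalDefs.IsQRational.pow
    (hφ : IsQRational q φ) (k : ℕ) : IsQRational q fun s => φ s ^ k := by
  induction k with
  | zero => simpa using isQRational_const q 1
  | succ k ih => simpa [pow_succ] using ih.mul hφ

/-- **`q^{1 − (a s + c₀)} = q^{1 − c₀} · (q^{-s})^a`** (`a ∈ ℕ`, `q ≠ 0`): along an affine exponent the tail ratio of B5 is a MONOMIAL in
`X = q^{-s}`. [cite: Casselman1980, §3] -/
theorem cpow_one_sub_affine (hq : q ≠ 0) (a : ℕ) (c₀ s : ℂ) :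
    (q : ℂ) ^ (1 - ((a : ℂ) * s + c₀)) = (q : ℂ) ^ (1 - c₀) * qVar q s ^ a := by
  rw [show (1 : ℂ) - ((a : ℂ) * s + c₀) = (1 - c₀) + -((a : ℂ) * s) by ring,
    Complex.cpow_add _ _ (by exact_mod_cast hq), ← qVar_def, qVar_natCast_mul]

/-- **`s ↦ q^{1 − (a s + c₀)}` is regular at every `s₀`** (`a ∈ ℕ`, `q ≠ 0`). [cite: Casselman1980, §3] -/
theorem isQRationalRegularAt_cpow_one_sub_affine (hq : q ≠ 0) (s₀ : ℂ) (a : ℕ) (c₀ : ℂ) :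
    IsQRationalRegularAt q s₀ fun s => (q : ℂ) ^ (1 - ((a : ℂ) * s + c₀)) :=
  ((isQRationalRegularAt_qVar_pow q s₀ a).const_mul ((q : ℂ) ^ (1 - c₀))).congr fun s => (cpow_one_sub_affine hq a c₀ s).symm

/-- `q^{1 − e} = q^{−(e − 1)}` is the variable `qVar q (e − 1)` of ★ F1. [cite: Casselman1980, §3] -/
theorem cpow_one_sub_eq_qVar (q : ℕ) (e : ℂ) : (q : ℂ) ^ (1 - e) = qVar q (e - 1) := by
  rw [qVar_def, neg_sub]

/-- **The normalised-tail identity**: `P + T · (t^{m+1} · (1 − t)⁻¹) = (1 − t)⁻¹ · ((1 − t) · P + T · t^{m+1})` for `1 − t ≠ 0` — «head +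
`L` × tail» is «`L` × bracket» with `L = (1 − t)⁻¹`. [cite: Casselman1980, §3 Thm. 3.1] [cite: KudlaSweet1997, §1] -/
theorem head_add_tail_eq_inv_mul (P T t : ℂ) (m : ℕ) (ht : 1 - t ≠ 0) :
    P + T * (t ^ (m + 1) * (1 - t)⁻¹) = (1 - t)⁻¹ * ((1 - t) * P + T * t ^ (m + 1)) := by
  field_simp

/-- **The bracket is regular at `s₀`**: for `u : ℂ` and functions `τ, P, T` regular at `s₀`,
`s ↦ (1 − u · τ s) · P s + T s · (u · τ s)^{m+1}` is regular at `s₀`. [cite: Casselman1980, §3] [cite: KudlaSweet1997, §1] -/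
theorem isQRationalRegularAt_bracket {τ P T : ℂ → ℂ} (u : ℂ) (m : ℕ) (hτ : IsQRationalRegularAt q s₀ τ)
    (hP : IsQRationalRegularAt q s₀ P) (hT : IsQRationalRegularAt q s₀ T) :
    IsQRationalRegularAt q s₀ fun s => (1 - u * τ s) * P s + T s * (u * τ s) ^ (m + 1) :=
  (((isQRationalRegularAt_const q s₀ 1).sub (hτ.const_mul u)).mul hP).add (hT.mul ((hτ.const_mul u).pow (m + 1)))

/-- a head sum `Σ_{y∈R} a · Ψ s y` (fixed finite `R`, fixed coefficient `a = μ(𝔭^r)`) is regular at `s₀` when each value family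
`s ↦ Ψ s y`, `y ∈ R`, is. [cite: Casselman1980, §3 Thm. 3.1] -/
theorem isQRationalRegularAt_headSum {α : Type*} (R : Finset α) (a : ℂ) {Ψ : ℂ → α → ℂ}
    (hΨ : ∀ y ∈ R, IsQRationalRegularAt q s₀ fun s => Ψ s y) :
    IsQRationalRegularAt q s₀ fun s => ∑ y ∈ R, a * Ψ s y :=
  IsQRationalRegularAt.sum R fun y hy => (hΨ y hy).const_mul a

/-- a finite combination `Σ_{i∈Y} c_i(s) · Φ_i(s)` of functions regular at `s₀` with coefficients regular at `s₀` is regular at `s₀`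
(file B2's expansion over representatives of `B \ H_w / K′`). [cite: Casselman1980, §3 Thm. 3.1] -/
theorem isQRationalRegularAt_sum_mul {ι : Type*} (Y : Finset ι) {c Φ : ι → ℂ → ℂ}
    (hc : ∀ i ∈ Y, IsQRationalRegularAt q s₀ (c i)) (hΦ : ∀ i ∈ Y, IsQRationalRegularAt q s₀ (Φ i)) :
    IsQRationalRegularAt q s₀ fun s => ∑ i ∈ Y, c i s * Φ i s :=
  IsQRationalRegularAt.sum Y fun i hi => (hc i hi).mul (hΦ i hi)

end Generic

/-! ## §2 At a completion `K_w`: «head + `L` × tail» = «`L` × (regular at `s₀`)» in ★ T1's currency, B5's output BY VALUE -/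

section Completion

variable {K : Type} [Field K] [NumberField K] {w : HeightOneSpectrum (𝓞 K)}

/-- `L(e − 1, ν) = (1 − unramValue ν · q_w^{1−e})⁻¹` (★ T1 `lFactor_def` at `z = e − 1`). [cite: Tate1950, §2.5] -/
theorem lFactor_sub_one (ν : (w.adicCompletion K)ˣ →* ℂˣ) (e : ℂ) :
    lFactor K w ν (e - 1) = (1 - unramValue K w ν * (residueFieldCard (w.adicCompletion K) : ℂ) ^ (1 - e))⁻¹ := by
  rw [lFactor_def, neg_sub]

/-- on the region of absolute convergence `1 < re e` and for `‖unramValue ν‖ ≤ 1` (unitary `ν`):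
`1 − unramValue ν · q_w^{1−e} ≠ 0`. [cite: Tate1950, §2.5] -/
theorem one_sub_unramValue_mul_cpow_ne_zero {ν : (w.adicCompletion K)ˣ →* ℂˣ} (hν : ‖unramValue K w ν‖ ≤ 1) {e : ℂ}
    (he : 1 < e.re) : 1 - unramValue K w ν * (residueFieldCard (w.adicCompletion K) : ℂ) ^ (1 - e) ≠ 0 := by
  rw [cpow_one_sub_eq_qVar]
  exact one_sub_mul_qVar_ne_zero (one_lt_residueFieldCard _) hν (by simp only [Complex.sub_re, Complex.one_re]; linarith)

/-- `L(e − 1, ν) ≠ 0` for `1 < re e`, `‖unramValue ν‖ ≤ 1`. [cite: Tate1950, §2.5] -/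
theorem lFactor_sub_one_ne_zero {ν : (w.adicCompletion K)ˣ →* ℂˣ} (hν : ‖unramValue K w ν‖ ≤ 1) {e : ℂ} (he : 1 < e.re) :
    lFactor K w ν (e - 1) ≠ 0 := by
  rw [lFactor_sub_one]
  exact inv_ne_zero (one_sub_unramValue_mul_cpow_ne_zero hν he)

/-- **`A_α f_s = L(e(s) − 1, ν) · N_α f_s` (B5's output BY VALUE).**  If on a parameter set `S ⊆ {1 < re e(s)}` a family of rank-one integrals
satisfies B5's closed formula `I(s) = HEAD(s) + T(s) · ((unramValue ν · q_w^{1−e(s)})^{m+1} · L(e(s) − 1, ν))` (`‖unramValue ν‖ ≤ 1`), then on `S`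
**`I(s) = L(e(s) − 1, ν) · ((1 − unramValue ν · q_w^{1−e(s)}) · HEAD(s) + T(s) · (unramValue ν · q_w^{1−e(s)})^{m+1})`** — the bracket is the
NORMAL FORM `N_α f_s`, written inline (no `def`; RULING M-156o (b)).  B5's literal output `Σ_{y∈R} μ(𝔭^r)·g_s(y) + C(s)·(1 − q⁻¹)·μ(𝒪)·(…)` is this
shape with `HEAD s := Σ …` and `T s := C s * (1 − q⁻¹) * μ.real 𝒪` (same association). [cite: Casselman1980, §3 Thm. 3.1] [cite: KudlaSweet1997, §1] -/
theorem eq_lFactor_mul_of_head_tail {ν : (w.adicCompletion K)ˣ →* ℂˣ} (hν : ‖unramValue K w ν‖ ≤ 1)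
    (e : ℂ → ℂ) (S : Set ℂ) (hS : ∀ s ∈ S, 1 < (e s).re) (I HEAD T : ℂ → ℂ) (m : ℕ)
    (hI : ∀ s ∈ S, I s = HEAD s + T s *
      ((unramValue K w ν * (residueFieldCard (w.adicCompletion K) : ℂ) ^ (1 - e s)) ^ (m + 1) * lFactor K w ν (e s - 1)))
    {s : ℂ} (hs : s ∈ S) :
    I s = lFactor K w ν (e s - 1) *
      ((1 - unramValue K w ν * (residueFieldCard (w.adicCompletion K) : ℂ) ^ (1 - e s)) * HEAD s +
        T s * (unramValue K w ν * (residueFieldCard (w.adicCompletion K) : ℂ) ^ (1 - e s)) ^ (m + 1)) := by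
  rw [hI s hs, lFactor_sub_one]
  exact head_add_tail_eq_inv_mul _ _ _ m (one_sub_unramValue_mul_cpow_ne_zero hν (hS s hs))

/-- **THE NORMAL FORM `N_α f_s` IS REGULAR AT `s₀`** when `HEAD`, `T` and `s ↦ q_w^{1−e(s)}` are (★ F1 closure; any `ν`, any `s₀`; no
convergence hypothesis — `N_α` never divides by `L`). [cite: Casselman1980, §3 Thm. 3.1] [cite: KudlaSweet1997, §1] -/
theorem isQRationalRegularAt_normalForm (ν : (w.adicCompletion K)ˣ →* ℂˣ) {e HEAD T : ℂ → ℂ} (m : ℕ) {s₀ : ℂ}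
    (he : IsQRationalRegularAt (residueFieldCard (w.adicCompletion K)) s₀ fun s =>
      (residueFieldCard (w.adicCompletion K) : ℂ) ^ (1 - e s))
    (hH : IsQRationalRegularAt (residueFieldCard (w.adicCompletion K)) s₀ HEAD)
    (hT : IsQRationalRegularAt (residueFieldCard (w.adicCompletion K)) s₀ T) :
    IsQRationalRegularAt (residueFieldCard (w.adicCompletion K)) s₀ fun s =>
      (1 - unramValue K w ν * (residueFieldCard (w.adicCompletion K) : ℂ) ^ (1 - e s)) * HEAD s +
        T s * (unramValue K w ν * (residueFieldCard (w.adicCompletion K) : ℂ) ^ (1 - e s)) ^ (m + 1) :=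
  isQRationalRegularAt_bracket (unramValue K w ν) m he hH hT

/-- affine exponent `e(s) = a s + c₀` (`a ∈ ℕ`): `s ↦ q_w^{1−e(s)}` is regular at every `s₀`. [cite: Casselman1980, §3] -/
theorem isQRationalRegularAt_cpow_one_sub_of_affine {e : ℂ → ℂ} (a : ℕ) (c₀ : ℂ) (he : ∀ s, e s = (a : ℂ) * s + c₀) (s₀ : ℂ) :
    IsQRationalRegularAt (residueFieldCard (w.adicCompletion K)) s₀ fun s =>
      (residueFieldCard (w.adicCompletion K) : ℂ) ^ (1 - e s) := by
  simp only [he]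
  exact isQRationalRegularAt_cpow_one_sub_affine (residueFieldCard_ne_zero _) s₀ a c₀

/-- **`N_α f_s` regular at `s₀`, in B5's literal currency**: head `Σ_{y∈R} a · Ψ s y` over a FIXED finite `R` with each value family
`s ↦ Ψ s y` regular at `s₀`, tail coefficient `T s = C s · b₁ · b₂` (`b₁ = 1 − q_w⁻¹`, `b₂ = μ(𝒪_w)`) with `C` regular at `s₀`, affine exponent
`e(s) = a' s + c₀`. [cite: Casselman1980, §3 Thm. 3.1] [cite: KudlaSweet1997, §1] -/
theorem isQRationalRegularAt_normalForm_headSum (ν : (w.adicCompletion K)ˣ →* ℂˣ) {α : Type*} (R : Finset α) (a : ℂ)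
    {Ψ : ℂ → α → ℂ} {C e : ℂ → ℂ} (b₁ b₂ : ℂ) (m : ℕ) {s₀ : ℂ} (a' : ℕ) (c₀ : ℂ) (he : ∀ s, e s = (a' : ℂ) * s + c₀)
    (hΨ : ∀ y ∈ R, IsQRationalRegularAt (residueFieldCard (w.adicCompletion K)) s₀ fun s => Ψ s y)
    (hC : IsQRationalRegularAt (residueFieldCard (w.adicCompletion K)) s₀ C) :
    IsQRationalRegularAt (residueFieldCard (w.adicCompletion K)) s₀ fun s =>
      (1 - unramValue K w ν * (residueFieldCard (w.adicCompletion K) : ℂ) ^ (1 - e s)) * (∑ y ∈ R, a * Ψ s y) +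
        C s * b₁ * b₂ * (unramValue K w ν * (residueFieldCard (w.adicCompletion K) : ℂ) ^ (1 - e s)) ^ (m + 1) :=
  isQRationalRegularAt_normalForm ν m (isQRationalRegularAt_cpow_one_sub_of_affine a' c₀ he s₀) (isQRationalRegularAt_headSum R a hΨ)
    ((hC.mul (isQRationalRegularAt_const _ s₀ b₁)).mul (isQRationalRegularAt_const _ s₀ b₂))

/-- **PACKAGED: `∃ Fn` regular at `s₀` with `I(s) = L(e(s) − 1, ν) · Fn(s)` on `S`** — the sentence of the repaired face (A4′-R) for ONE
rank-one factor of the cocycle (at use `s₀ = ½`, `S = {1 < re s}`). [cite: Casselman1980, §3 Thm. 3.1] [cite: KudlaSweet1997, §1] -/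
theorem exists_regular_factorisation {ν : (w.adicCompletion K)ˣ →* ℂˣ} (hν : ‖unramValue K w ν‖ ≤ 1)
    (e : ℂ → ℂ) (S : Set ℂ) (hS : ∀ s ∈ S, 1 < (e s).re) (I HEAD T : ℂ → ℂ) (m : ℕ)
    (hI : ∀ s ∈ S, I s = HEAD s + T s *
      ((unramValue K w ν * (residueFieldCard (w.adicCompletion K) : ℂ) ^ (1 - e s)) ^ (m + 1) * lFactor K w ν (e s - 1)))
    {s₀ : ℂ}
    (he : IsQRationalRegularAt (residueFieldCard (w.adicCompletion K)) s₀ fun s =>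
      (residueFieldCard (w.adicCompletion K) : ℂ) ^ (1 - e s))
    (hH : IsQRationalRegularAt (residueFieldCard (w.adicCompletion K)) s₀ HEAD)
    (hT : IsQRationalRegularAt (residueFieldCard (w.adicCompletion K)) s₀ T) :
    ∃ Fn : ℂ → ℂ, IsQRationalRegularAt (residueFieldCard (w.adicCompletion K)) s₀ Fn ∧
      ∀ s ∈ S, I s = lFactor K w ν (e s - 1) * Fn s :=
  ⟨_, isQRationalRegularAt_normalForm ν m he hH hT,
    fun _ hs => eq_lFactor_mul_of_head_tail hν e S hS I HEAD T m hI hs⟩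

/-- **ENTIRE version**: data regular at EVERY `s₀` give one `Fn` regular at every `s₀` (the normalised rank-one operator maps «entire»
level-`K′` families to «entire» families). [cite: Casselman1980, §3 Thm. 3.1] [cite: KudlaSweet1997, §1] -/
theorem exists_entire_factorisation {ν : (w.adicCompletion K)ˣ →* ℂˣ} (hν : ‖unramValue K w ν‖ ≤ 1)
    (e : ℂ → ℂ) (S : Set ℂ) (hS : ∀ s ∈ S, 1 < (e s).re) (I HEAD T : ℂ → ℂ) (m : ℕ)
    (hI : ∀ s ∈ S, I s = HEAD s + T s *
      ((unramValue K w ν * (residueFieldCard (w.adicCompletion K) : ℂ) ^ (1 - e s)) ^ (m + 1) * lFactor K w ν (e s - 1)))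
    (he : ∀ s₀, IsQRationalRegularAt (residueFieldCard (w.adicCompletion K)) s₀ fun s =>
      (residueFieldCard (w.adicCompletion K) : ℂ) ^ (1 - e s))
    (hH : ∀ s₀, IsQRationalRegularAt (residueFieldCard (w.adicCompletion K)) s₀ HEAD)
    (hT : ∀ s₀, IsQRationalRegularAt (residueFieldCard (w.adicCompletion K)) s₀ T) :
    ∃ Fn : ℂ → ℂ, (∀ s₀, IsQRationalRegularAt (residueFieldCard (w.adicCompletion K)) s₀ Fn) ∧
      ∀ s ∈ S, I s = lFactor K w ν (e s - 1) * Fn s :=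
  ⟨_, fun s₀ => isQRationalRegularAt_normalForm ν m (he s₀) (hH s₀) (hT s₀),
    fun _ hs => eq_lFactor_mul_of_head_tail hν e S hS I HEAD T m hI hs⟩

/-- **where the `L`-factor is alive-regular**: for `1 < re e(s₀)` and `‖unramValue ν‖ ≤ 1` the family `s ↦ L(e(s) − 1, ν)` is itself
regular at `s₀` (if `s ↦ q_w^{1−e(s)}` is). [cite: Tate1950, §2.5] [cite: KudlaSweet1997, §1] -/
theorem isQRationalRegularAt_lFactor_family {ν : (w.adicCompletion K)ˣ →* ℂˣ} (hν : ‖unramValue K w ν‖ ≤ 1) {e : ℂ → ℂ} {s₀ : ℂ}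
    (he : IsQRationalRegularAt (residueFieldCard (w.adicCompletion K)) s₀ fun s =>
      (residueFieldCard (w.adicCompletion K) : ℂ) ^ (1 - e s))
    (h0 : 1 < (e s₀).re) :
    IsQRationalRegularAt (residueFieldCard (w.adicCompletion K)) s₀ fun s => lFactor K w ν (e s - 1) := by
  have h1 : IsQRationalRegularAt (residueFieldCard (w.adicCompletion K)) s₀ fun s =>
      1 - unramValue K w ν * (residueFieldCard (w.adicCompletion K) : ℂ) ^ (1 - e s) :=
    (isQRationalRegularAt_const _ s₀ 1).sub (he.const_mul _)
  refine (h1.inv (one_sub_unramValue_mul_cpow_ne_zero hν h0)).congr fun s => ?_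
  rw [lFactor_sub_one]

/-- **… and then the continuation `L · Fn` of `I` is regular at `s₀`** (the first two cocycle factors at `s₀ = ½`, where `e(½) − 1 = 2, 1`).
[cite: Casselman1980, §3 Thm. 3.1] [cite: KudlaSweet1997, §1] -/
theorem isQRationalRegularAt_lFactor_mul_normalForm {ν : (w.adicCompletion K)ˣ →* ℂˣ} (hν : ‖unramValue K w ν‖ ≤ 1) {e Fn : ℂ → ℂ} {s₀ : ℂ}
    (he : IsQRationalRegularAt (residueFieldCard (w.adicCompletion K)) s₀ fun s =>
      (residueFieldCard (w.adicCompletion K) : ℂ) ^ (1 - e s))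
    (h0 : 1 < (e s₀).re) (hFn : IsQRationalRegularAt (residueFieldCard (w.adicCompletion K)) s₀ Fn) :
    IsQRationalRegularAt (residueFieldCard (w.adicCompletion K)) s₀ fun s => lFactor K w ν (e s - 1) * Fn s :=
  (isQRationalRegularAt_lFactor_family hν he h0).mul hFn

/-- **RAMIFIED `ν`: no `L`-factor at all** — `unramValue ν = 0`, `L = 1`, and the bracket IS the head: on `S`, `I(s) = HEAD(s)`.
[cite: Tate1950, §2.5] [cite: KudlaSweet1997, §1] -/
theorem eq_head_of_not_isUnramifiedChar {ν : (w.adicCompletion K)ˣ →* ℂˣ} (hram : ¬ IsUnramifiedChar ν)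
    (e : ℂ → ℂ) (S : Set ℂ) (I HEAD T : ℂ → ℂ) (m : ℕ)
    (hI : ∀ s ∈ S, I s = HEAD s + T s *
      ((unramValue K w ν * (residueFieldCard (w.adicCompletion K) : ℂ) ^ (1 - e s)) ^ (m + 1) * lFactor K w ν (e s - 1)))
    {s : ℂ} (hs : s ∈ S) : I s = HEAD s := by
  rw [hI s hs, unramValue_of_not K w hram, zero_mul, zero_pow (Nat.succ_ne_zero m), zero_mul, mul_zero, add_zero]

end Completion

/-! ## §3 Linearity over a finite expansion -/

section Linearity

variable {K : Type} [Field K] [NumberField K] {w : HeightOneSpectrum (𝓞 K)} {ι : Type*}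

/-- **finite combinations**: if `I_i(s) = L(e(s) − 1, ν) · Fn_i(s)` on `S` for every `i ∈ Y`, then
`Σ_{i∈Y} c_i(s) · I_i(s) = L(e(s) − 1, ν) · Σ_{i∈Y} c_i(s) · Fn_i(s)` on `S` (a level-`K′` family is the combination of the basis sections over
representatives `y_i`, `i ∈ Y`, of `B \ H_w / K′` with coefficients its values `c_i(s) = f_s(y_i)`; for FLAT (standard) families these are
`q_w^{-s}`-MONOMIALS × constants — `f_s(p k) = χ_s(p) f(k)` — so the representative-value lemma is stated directly in `IsQRationalRegularAt`
currency through `isQRationalRegularAt_cpow_one_sub_affine`-type one-liners, no bridge lemma). [cite: Casselman1980, §3 Thm. 3.1] -/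
theorem sum_mul_eq_lFactor_mul (Y : Finset ι) (ν : (w.adicCompletion K)ˣ →* ℂˣ) (e : ℂ → ℂ) (S : Set ℂ)
    (I Fn c : ι → ℂ → ℂ) (hI : ∀ i ∈ Y, ∀ s ∈ S, I i s = lFactor K w ν (e s - 1) * Fn i s) {s : ℂ} (hs : s ∈ S) :
    ∑ i ∈ Y, c i s * I i s = lFactor K w ν (e s - 1) * ∑ i ∈ Y, c i s * Fn i s := by
  rw [Finset.mul_sum]
  exact Finset.sum_congr rfl fun i hi => by rw [hI i hi s hs]; ring

/-- **PACKAGED linearity**: factorisations `I_i = L · Fn_i` on `S` with `Fn_i` regular at `s₀` and coefficients `c_i` regular at `s₀`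
combine to `Σ_i c_i I_i = L · Fn` with `Fn` regular at `s₀`. [cite: Casselman1980, §3 Thm. 3.1] [cite: KudlaSweet1997, §1] -/
theorem exists_regular_factorisation_sum (Y : Finset ι) (ν : (w.adicCompletion K)ˣ →* ℂˣ) (e : ℂ → ℂ) (S : Set ℂ)
    (I Fn c : ι → ℂ → ℂ) (hI : ∀ i ∈ Y, ∀ s ∈ S, I i s = lFactor K w ν (e s - 1) * Fn i s) {s₀ : ℂ}
    (hFn : ∀ i ∈ Y, IsQRationalRegularAt (residueFieldCard (w.adicCompletion K)) s₀ (Fn i))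
    (hc : ∀ i ∈ Y, IsQRationalRegularAt (residueFieldCard (w.adicCompletion K)) s₀ (c i)) :
    ∃ G : ℂ → ℂ, IsQRationalRegularAt (residueFieldCard (w.adicCompletion K)) s₀ G ∧
      ∀ s ∈ S, ∑ i ∈ Y, c i s * I i s = lFactor K w ν (e s - 1) * G s :=
  ⟨fun s => ∑ i ∈ Y, c i s * Fn i s, isQRationalRegularAt_sum_mul Y hc hFn,
    fun _ hs => sum_mul_eq_lFactor_mul Y ν e S I Fn c hI hs⟩

/-- **scalar factors pull through** (the outer `L`-factors of earlier cocycle steps ride along: `A_{α'}(L' · G) = L' · A_{α'} G`, so a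
factorisation of `I` gives one of `L' · I`). [cite: Casselman1980, §3 Thm. 3.1] -/
theorem const_mul_eq_lFactor_mul (ν : (w.adicCompletion K)ˣ →* ℂˣ) (e : ℂ → ℂ) (S : Set ℂ) (I Fn L' : ℂ → ℂ)
    (hI : ∀ s ∈ S, I s = lFactor K w ν (e s - 1) * Fn s) {s : ℂ} (hs : s ∈ S) :
    L' s * I s = lFactor K w ν (e s - 1) * (L' s * Fn s) := by
  rw [hI s hs]
  ring

end Linearity

end Summit.HodgeConjecture.HodgeConjecture.Cruxes.HLiu418.K2LiuRankOneFamilies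

end
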